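import Mathlib.Data.Nat.Choose.Basic
import Mathlib.Analysis.SpecialFunctions.Pow.Real
import Mathlib.Tactic

/-!
# GraphCompletenessRegister — arithmetic receipts of DEQ-A169 (cell `pub-qadeq`, CLAIMS A-169)

HONEST FRAMING: instance-level adjudication of specific advantage claims; no claim about BQP vs BPP
or the summit.

Giordano–Martin-Delgado, ‘Single Link Removal Perturbation in Szegedy Quantum Walk: from Graph
Completeness Testing to Integrity Monitoring’, arXiv:2607.19129v1 (2026) [GiordanoMartinDelgado2026SLR],
Appendix G, restates the completeness test of [GiordanoMartinDelgado2026] (CLAIMS A-168; tree files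
`GraphCompletenessQueryFloor`, `GraphCompletenessWalkCount`) with the QPE register
`p ∼ (5/2) log₂ n + O(1)` (eq. (190)) and concludes ‘total time complexity … remains O(log² n)’.
This file records, with no `Prop` definitions and no new facts:

* `walkCount_ge_pairs` — on any register with `2^p ≥ n^{5/2}` (stated over `ℕ` as `n^5 ≤ 4^p`) the
  `2^p - 1` controlled-walk applications of one QPE run (Cleve–Ekert–Macchiavello–Mosca 1998 §5;
  tree `GraphCompletenessWalkCount.qpe_controlled_applications`) are at least the `C(n,2)` classical
  pair look-ups that decide completeness exactly (DEQ-A169 Lemma A169-2 (i));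
* `register_n300` — the instance `n = 300`, `p = 21`;
* `reduced_charpoly_at_gap` — the identity of DEQ-A169 Prop. A169-3 (iv): with `p = 1/(n-1)`,
  `k = n - m`, `λ⋆ = (k-1)p`, the reduced characteristic polynomial
  `f(λ) = λ² − (k−3)p·λ − 2(k−2)p/(n−2)` of the perturbed discriminant block satisfies
  `f(λ⋆) = 2m/((n−1)²(n−2))`;
* `gap_root_lt`, `exact_gap_decreases` — hence every root of `f` (in particular the exact perturbed gap
  eigenvalue `λ̃⋆`, DEQ-A169 Prop. A169-3 (ii)) is `< λ⋆` whenever `m > 0`, `2 ≤ k`, `2 < n`;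
* `firstOrder_at_m_zero_neg` — the printed first-order formula (42) of the paper evaluated at `m = 0`
  (inside its stated range `0 ≤ m ≤ n − 2`) is strictly negative for `n > 2`, whereas the exact top
  eigenvalue does not move there (reversible chain; DEQ-A169 Prop. A169-3 (iii), certified numerically,
  not formalised here).

That `λ̃⋆` is the larger root of `f` (the symmetry reduction) is certified numerically in DEQ-A169
(C-A169-1, C-A169-2, C-A169-11), not formalised here.
-/

namespace Summit.QuantumAdvantage.Dequantization.GraphCompletenessRegister

/-! ### The walk count on the paper's own register -/

/-- If `n^5 ≤ 4^p` (i.e. `2^p ≥ n^{5/2}`, the register size `p ∼ (5/2) log₂ n` of arXiv:2607.19129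
eq. (190)), then the `2^p - 1` controlled-walk applications of one QPE run are at least the `C(n,2)`
classical adjacency look-ups. -/
theorem walkCount_ge_pairs (n p : ℕ) (h : n ^ 5 ≤ 4 ^ p) : n.choose 2 ≤ 2 ^ p - 1 := by
  have h4 : (4 : ℕ) ^ p = (2 ^ p) ^ 2 := by
    rw [← pow_mul, mul_comm, pow_mul]; norm_num
  have hn2 : n ^ 2 ≤ 2 ^ p := by
    rcases Nat.eq_zero_or_pos n with rfl | hn
    · simp
    · have h45 : n ^ 4 ≤ n ^ 5 := Nat.pow_le_pow_right hn (by norm_num)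
      have h' : (n ^ 2) ^ 2 ≤ (2 ^ p) ^ 2 := by
        rw [← h4]
        calc (n ^ 2) ^ 2 = n ^ 4 := by ring
          _ ≤ n ^ 5 := h45
          _ ≤ 4 ^ p := h
      by_contra hc
      push Not at hc
      have : (2 ^ p) ^ 2 < (n ^ 2) ^ 2 := Nat.pow_lt_pow_left hc (by norm_num)
      omega
  have h1 : 1 ≤ 2 ^ p := Nat.one_le_two_pow
  have hA : n * (n - 1) ≤ 2 ^ p :=
    le_trans (Nat.mul_le_mul_left n (Nat.sub_le n 1)) (by simpa [sq] using hn2)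
  rw [Nat.choose_two_right]
  calc n * (n - 1) / 2 ≤ 2 ^ p / 2 := Nat.div_le_div_right hA
    _ ≤ 2 ^ p - 1 := by omega

/-- The instance at the largest size simulated in [GiordanoMartinDelgado2026]: `n = 300`,
`p = ⌈(5/2) log₂ 300⌉ = 21`: `300^5 ≤ 4^21`, so `C(300,2) = 44 850 ≤ 2^21 − 1 = 2 097 151`. -/
theorem register_n300 : (300 : ℕ) ^ 5 ≤ 4 ^ 21 ∧ Nat.choose 300 2 = 44850 ∧ 2 ^ 21 - 1 = 2097151 ∧
    Nat.choose 300 2 ≤ 2 ^ 21 - 1 := by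
  refine ⟨by norm_num, by norm_num [Nat.choose_two_right], by norm_num, ?_⟩
  exact walkCount_ge_pairs 300 21 (by norm_num)

/-! ### The reduced characteristic polynomial at the unperturbed gap eigenvalue -/

/-- DEQ-A169 Prop. A169-3 (iv): with `p = 1/(n−1)`, `k = n − m`, `λ⋆ = (k−1)p` and
`f(λ) = λ² − (k−3)p·λ − 2(k−2)p/(n−2)` (the characteristic polynomial of the `2 × 2` symmetry
reduction of the perturbed discriminant block), `f(λ⋆) = 2m/((n−1)²(n−2))`. -/
theorem reduced_charpoly_at_gap (n m : ℝ) (hn1 : n - 1 ≠ 0) (hn2 : n - 2 ≠ 0) :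
    ((n - m - 1) / (n - 1)) ^ 2 - (n - m - 3) / (n - 1) * ((n - m - 1) / (n - 1))
      - 2 * (n - m - 2) / ((n - 1) * (n - 2)) = 2 * m / ((n - 1) ^ 2 * (n - 2)) := by
  field_simp
  ring

/-- If `x` is a root of `t² − B t − C` with `C ≥ 0`, and `y > 0` has `y² − B y − C > 0`, then `x < y`:
the quadratic is nonpositive between its nonpositive root and its nonnegative root. -/
theorem gap_root_lt {B C x y : ℝ} (hC : 0 ≤ C) (hx : x ^ 2 - B * x - C = 0) (hy : 0 < y)
    (hfy : 0 < y ^ 2 - B * y - C) : x < y := by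
  by_contra h
  push Not at h
  have hx0 : 0 < x := lt_of_lt_of_le hy h
  have key : (y - x) * (y - (B - x)) = y ^ 2 - B * y - C := by
    linear_combination (-1 : ℝ) * hx
  have h2 : B - x ≤ 0 := by
    by_contra h2
    push Not at h2
    nlinarith [mul_pos hx0 h2]
  have h3 : (y - x) * (y - (B - x)) ≤ 0 :=
    mul_nonpos_of_nonpos_of_nonneg (by linarith) (by linarith)
  linarith

/-- **Exact decrease of the gap eigenvalue** (the conjecture of [GiordanoMartinDelgado2026], for the
reason given in DEQ-A169 Prop. A169-3 (iv), not the first-order one): every root `x` of the reduced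
characteristic polynomial — in particular the exact perturbed gap eigenvalue — lies strictly below
`λ⋆ = (n − m − 1)/(n − 1)` as soon as `m > 0`, `n − m ≥ 2` and `n > 2`. -/
theorem exact_gap_decreases (n m x : ℝ) (hn : 2 < n) (hm : 0 < m) (hk : 2 ≤ n - m)
    (hx : x ^ 2 - (n - m - 3) / (n - 1) * x - 2 * (n - m - 2) / ((n - 1) * (n - 2)) = 0) :
    x < (n - m - 1) / (n - 1) := by
  have hn1 : (0 : ℝ) < n - 1 := by linarith
  have hn2 : (0 : ℝ) < n - 2 := by linarith
  have hC : (0 : ℝ) ≤ 2 * (n - m - 2) / ((n - 1) * (n - 2)) :=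
    div_nonneg (by linarith) (le_of_lt (mul_pos hn1 hn2))
  have hy : (0 : ℝ) < (n - m - 1) / (n - 1) := div_pos (by linarith) hn1
  have hid := reduced_charpoly_at_gap n m (ne_of_gt hn1) (ne_of_gt hn2)
  have hfy : (0 : ℝ) < ((n - m - 1) / (n - 1)) ^ 2 - (n - m - 3) / (n - 1) * ((n - m - 1) / (n - 1))
      - 2 * (n - m - 2) / ((n - 1) * (n - 2)) := by
    rw [hid]
    exact div_pos (by linarith) (mul_pos (pow_pos hn1 2) hn2)
  exact gap_root_lt hC hx hy hfy

/-! ### The printed first-order formula at `m = 0` -/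

/-- Eq. (42) of arXiv:2607.19129 at `m = 0`, `k = n`, `p = 1/(n−1)`:
`Δλ⋆ = −(2p/(n(n−2)))·(n−2)(√(n−1) − √(n−2))²` is strictly NEGATIVE for every real `n > 2` —
whereas with no marked node the exact top eigenvalue of the (still reversible) walk does not move
(DEQ-A169 Prop. A169-3 (iii)); so (42) is the first-order term, not the exact shift. -/
theorem firstOrder_at_m_zero_neg (n : ℝ) (hn : 2 < n) :
    -(2 * (1 / (n - 1)) / (n * (n - 2))) * ((0 : ℝ) + (n - 2) * (Real.sqrt (n - 1) - Real.sqrt (n - 2)) ^ 2)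
      < 0 := by
  have hn0 : (0 : ℝ) < n := by linarith
  have hn1 : (0 : ℝ) < n - 1 := by linarith
  have hn2 : (0 : ℝ) < n - 2 := by linarith
  have hne : Real.sqrt (n - 1) - Real.sqrt (n - 2) ≠ 0 := by
    intro h
    have h' : Real.sqrt (n - 1) = Real.sqrt (n - 2) := sub_eq_zero.mp h
    rw [Real.sqrt_inj (le_of_lt hn1) (le_of_lt hn2)] at h'
    linarith
  have hsq : 0 < (Real.sqrt (n - 1) - Real.sqrt (n - 2)) ^ 2 := by positivity
  have hbr : 0 < (0 : ℝ) + (n - 2) * (Real.sqrt (n - 1) - Real.sqrt (n - 2)) ^ 2 := by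
    have := mul_pos hn2 hsq; linarith
  have hcoef : 0 < 2 * (1 / (n - 1)) / (n * (n - 2)) := by positivity
  nlinarith [mul_pos hcoef hbr]

end Summit.QuantumAdvantage.Dequantization.GraphCompletenessRegister
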